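import Mathlib.CategoryTheory.Adjunction.Unique
import Literature.AnabelianGeometry.SemiGraphs.HomComposition
import Literature.AnabelianGeometry.SemiGraphs.FiniteEtaleCoveringGlobalDef
import Literature.AnabelianGeometry.SemiGraphs.FiniteEtaleCoveringVertexAligned
import Literature.AnabelianGeometry.SemiGraphs.BObjFunctors
import Literature.AnabelianGeometry.SemiGraphs.CoveringLift
import Literature.AnabelianGeometry.SemiGraphs.CoveringOfObjectVertexAligned
import Literature.AnabelianGeometry.Anabelioids.FiberFunctorUnique
import HarnessLib

/-!
# The identity 1-morphism of a semi-graph of anabelioids is a finite étale covering in print's sense: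
# global clause, branch alignment, vertex alignment ([SemiAnbd] §2, Def. 2.2 (i) p. 23 / Rmk. 2.4.2 p. 26)

Mochizuki, *Semi-graphs of anabelioids*, Publ. RIMS **42** (2006) 221–322, §2: Definition 2.2 (i)
p. 23 (the finite étale covering `𝒢' → 𝒢` attached to an object `G'` of `B(𝒢)`: "`B' = B(𝒢)_{G'}` …
arises naturally as the `B(−)` of some … `𝒢'` equipped with a morphism `𝒢' → 𝒢`"), Remark 2.4.2
p. 26 (1-morphisms of semi-graphs of anabelioids "form a category"), Remark 2.11.1 p. 32 (a morphism
"determines, in a natural fashion, a morphism `B(𝒢) → B(ℋ)`").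
[cite: MochizukiSemiAnbd2006, Def. 2.2(i) p.23] [cite: MochizukiSemiAnbd2006, Rem. 2.4.2 p.26]

abc-iut cell, block F (FACT-LIST rows F-1492 `Hom.IsBranchAligned`, F-1493 `Hom.IsGlobalCoveringOf`,
F-2531 `Hom.IsVertexAligned`; seat abc-iut-f-005).  The three rows are PREDICATES on a morphism of
semi-graphs of anabelioids — the clauses of print's covering notion beyond the local description
(`Hom.IsFiniteEtaleCoveringGlobal` = local ∧ global ∧ branch-aligned ∧ vertex-aligned,
`Coverticial.lean`).  Their universal closures are refuted in the tree
(`Hom.not_forall_isBranchAligned`, `Hom.not_forall_isGlobalCoveringOf`, `Hom.not_forall_isVertexAligned`)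
and they hold for print's CONSTRUCTED covering `𝒢_A → 𝒢` (`BObj.coveringHomCan_isBranchAligned`,
`…_isGlobalCoveringOf`, `…_isVertexAligned`).  This PROOF-ONLY file adds the second named instance
announced in the trunk docstrings (`FiniteEtaleCoveringGlobalDef.lean`, "G1: for the identity covering
(`A` terminal) all clauses hold with `α` the equivalence `Over ⊤ ≌ B(𝒢)` and identity 2-cells") — the
IDENTITY 1-morphism `Hom.id 𝒢` (`HomComposition.lean`), i.e. the unit half of Rmk. 2.4.2's "morphisms
form a category" at the level of print's coverings (the composition half is the F-1478 programme,
`FiniteEtaleCoveringComp.lean`):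

* `Hom.gluingIso_id_hom_app`, `Hom.idPullbackIso : (Hom.id 𝒢).pullbackFunctor ≅ 𝟭 B(𝒢)` — the unit
  of the functoriality of `B(−)` (Rmk. 2.11.1), the identity on vertex and edge objects (data: a
  canonical isomorphism, no `Prop` is defined in this file);
* `Hom.id_isGlobalCoveringOf (hA : IsTerminal A) : (Hom.id 𝒢).IsGlobalCoveringOf A` — the global
  clause `B(𝒢) ≃ B(𝒢)_{/A}` via `id^*`, with `α := Over.forget A` (`Over.equivalenceOfIsTerminal`) and
  `id^* ≅ 𝟭 ≅ (A × −) ⋙ forget A` by uniqueness of the right adjoint of `forget A`;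
* `Hom.id_isBranchAligned : (Hom.id 𝒢).IsBranchAligned` — clause (i): the aligned branch subgroup of
  the identity IS the branch subgroup (`Hom.id_alignedBranchSubgroup_eq`, the aligned frame being the
  given frame up to unitors); clause (ii) is vacuous (the identity is injective on branches);
* `Hom.id_isVertexAligned : (Hom.id 𝒢).IsVertexAligned` — `ι = π₁(id^*)` composed with the basepoint
  transport `e` carries the verticial subgroup for `F'` onto the verticial subgroup for `F`
  (`Hom.id_ι_piVToPi`); clause (b) by the conjugating element of `map_range_pi1Map_autMulEquivOfIso`
  ([SGA1 V 5.7]: fibre functors of `𝒢_v` are isomorphic, `nonempty_iso_of_fiberFunctor`).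

Honest framing: instance forms at ONE named instance (the identity); the local description
`Hom.IsFiniteEtaleCoveringOf (Hom.id 𝒢) A` (components of a terminal object) is not treated in this
file.  Nothing here takes a side on [IUTchIII] Cor. 3.12; a FACT row is an assumption label; proved =
OUR kernel check only.
-/

namespace Literature.AnabelianGeometry.SemiGraphs

open CategoryTheory CategoryTheory.Limits CategoryTheory.Functor CategoryTheory.PreGaloisCategory
open Literature.AnabelianGeometry.Anabelioids
open scoped Pointwise

universe v₁ u₁ u

/-! ### A. Generic bookkeeping: `π₁` of an identity functor -/

section Generic

variable {C : Type*} [Category C]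

/-- `π₁(𝟭) = id`: whiskering an automorphism of a basepoint with the identity functor does not change
its components. [cite: MochizukiGeoAn2004, Def. 1.1.2(ii) p.10] -/
theorem pi1Map_id_apply (F : C ⥤ FintypeCat.{v₁}) (σ : Aut F) : pi1Map (𝟭 C) F σ = σ :=
  Iso.ext (NatTrans.ext (funext fun _ => rfl))

end Generic

namespace SemiGraphOfAnabelioids

variable {𝒢 : SemiGraphOfAnabelioids.{v₁, u₁, u}}

/-! ### B. The pull-back functor of the identity is the identity (`B(−)` is unital) -/

/-- The gluing isomorphism of `id^* A` along a branch `b` is the gluing isomorphism `ψ_b` of `A`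
(the 2-cell `id_b` is a unitor, `id_e^* = 𝟭`, the re-indexing is trivial).
[cite: MochizukiSemiAnbd2006, Rem. 2.11.1 p.32] -/
theorem Hom.gluingIso_id_hom_app (b : 𝒢.graph.Branch) (v : 𝒢.graph.Vertex)
    (h : 𝒢.graph.abuts b = some v) (A : 𝒢.BObj) :
    ((Hom.id 𝒢).gluingIso b v h).hom.app A = (A.ψ b v h).hom := by
  simp only [Hom.gluingIso, Iso.trans_hom, NatTrans.comp_app, Functor.isoWhiskerLeft_hom,
    Functor.whiskerLeft_app, Functor.isoWhiskerRight_hom, Functor.whiskerRight_app, Hom.reindexIso,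
    eqToIso.hom, eqToHom_app, ψNatIso, NatIso.ofComponents_hom_app]
  change ((𝒢.pull b v h).pullback.leftUnitor ≪≫ (𝒢.pull b v h).pullback.rightUnitor.symm).hom.app
      (A.S v) ≫ (A.ψ b v h).hom ≫ 𝟙 _ = (A.ψ b v h).hom
  simp only [Iso.trans_hom, Iso.symm_hom, NatTrans.comp_app, Functor.leftUnitor_hom_app,
    Functor.rightUnitor_inv_app, Category.comp_id, Category.assoc]
  erw [Category.id_comp, Category.id_comp]

/-- **`id^* ≅ 𝟭` on `B(𝒢)`** ([SemiAnbd] Rmk. 2.11.1 / Rmk. 2.4.2: the morphism `B(𝒢) → B(𝒢)`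
determined by the identity 1-morphism is the identity): the canonical isomorphism, the identity on
vertex objects `id_v^* A_v = A_v` and edge objects (the gluings agree by `Hom.gluingIso_id_hom_app`).
[cite: MochizukiSemiAnbd2006, Rem. 2.11.1 p.32] -/
noncomputable def Hom.idPullbackIso : (Hom.id 𝒢).pullbackFunctor ≅ 𝟭 𝒢.BObj :=
  NatIso.ofComponents
    (fun A => BObj.isoMk (fun _ => Iso.refl _) (fun _ => Iso.refl _) (fun b v h => by
      erw [CategoryTheory.Functor.map_id, Category.id_comp, Category.comp_id]
      exact (Hom.gluingIso_id_hom_app b v h A).symm))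
    (fun g => by
      ext
      · dsimp only [BObj.comp_fS, BObj.isoMk_hom_fS, Iso.refl_hom]
        erw [Category.comp_id, Category.id_comp]
        rfl
      · dsimp only [BObj.comp_fT, BObj.isoMk_hom_fT, Iso.refl_hom]
        erw [Category.comp_id, Category.id_comp]
        rfl)

/-- Vertex components of `idPullbackIso` are identities. [cite: MochizukiSemiAnbd2006, Rem. 2.11.1 p.32] -/
@[simp] theorem Hom.idPullbackIso_hom_app_fS (A : 𝒢.BObj) (v : 𝒢.graph.Vertex) :
    ((Hom.idPullbackIso (𝒢 := 𝒢)).hom.app A).fS v = 𝟙 _ := rfl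

/-- Edge components of `idPullbackIso` are identities. [cite: MochizukiSemiAnbd2006, Rem. 2.11.1 p.32] -/
@[simp] theorem Hom.idPullbackIso_hom_app_fT (A : 𝒢.BObj) (e : 𝒢.graph.Edge) :
    ((Hom.idPullbackIso (𝒢 := 𝒢)).hom.app A).fT e = 𝟙 _ := rfl

/-- Vertex components of the inverse of `idPullbackIso` are identities.
[cite: MochizukiSemiAnbd2006, Rem. 2.11.1 p.32] -/
@[simp] theorem Hom.idPullbackIso_inv_app_fS (A : 𝒢.BObj) (v : 𝒢.graph.Vertex) :
    ((Hom.idPullbackIso (𝒢 := 𝒢)).inv.app A).fS v = 𝟙 _ := rfl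

/-- Edge components of the inverse of `idPullbackIso` are identities.
[cite: MochizukiSemiAnbd2006, Rem. 2.11.1 p.32] -/
@[simp] theorem Hom.idPullbackIso_inv_app_fT (A : 𝒢.BObj) (e : 𝒢.graph.Edge) :
    ((Hom.idPullbackIso (𝒢 := 𝒢)).inv.app A).fT e = 𝟙 _ := rfl

/-! ### C. The global clause for the identity: `B(𝒢) ≃ B(𝒢)_{/A}` for `A` terminal -/

/-- **The identity 1-morphism is GLOBALLY the covering attached to a terminal object of `B(𝒢)`**
([SemiAnbd] Def. 2.2 (i), the case `G' = ⊤`: "`B(𝒢)_{G'}` … arises as the `B(−)` of" `𝒢` itself):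
`α := forget A : B(𝒢)_{/A} ⥤ B(𝒢)` is an equivalence for `A` terminal (`Over.equivalenceOfIsTerminal`),
and `id^* ≅ 𝟭 ≅ α⁻¹ ⋙ α ≅ (A × −) ⋙ α`, the last step by uniqueness of the right adjoint of `forget A`
(`forget A ⊣ A × −`, `Over.forgetAdjStar`). [cite: MochizukiSemiAnbd2006, Def. 2.2(i) p.23] -/
theorem Hom.id_isGlobalCoveringOf {A : 𝒢.BObj} (hA : IsTerminal A) :
    (Hom.id 𝒢).IsGlobalCoveringOf A := by
  haveI := hasBinaryProducts_bObj 𝒢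
  let e : Over A ≌ 𝒢.BObj := Over.equivalenceOfIsTerminal hA
  let i : Over.star A ≅ e.inverse := (Over.forgetAdjStar A).rightAdjointUniq e.toAdjunction
  exact ⟨inferInstance, e.functor, e.isEquivalence_functor,
    ⟨Hom.idPullbackIso ≪≫ e.counitIso.symm ≪≫ Functor.isoWhiskerRight i.symm e.functor⟩⟩

/-! ### D. Branch alignment of the identity -/

/-- **The aligned branch subgroup of the identity is the branch subgroup**: for a branch `b'` at `v'`
with basepoint data `(F', F_e', α')`, the aligned frame of `id` at `b' ↦ b'` is `α'` up to the unitor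
2-cell `id_{b'}`, so `Π_{b'}^{al} = Π_{b'}` inside `Π_{v'}`. [cite: MochizukiSemiAnbd2006, Rem. 2.4.1 p.26] -/
theorem Hom.id_alignedBranchSubgroup_eq (b' : 𝒢.graph.Branch) (v' : 𝒢.graph.Vertex)
    (h' : 𝒢.graph.abuts b' = some v') (b : 𝒢.graph.Branch) (p : (Hom.id 𝒢).base.branchMap b' = b)
    (F' : 𝒢.V v' ⥤ FintypeCat.{v₁}) (Fe' : 𝒢.E (𝒢.graph.edgeOf b') ⥤ FintypeCat.{v₁})
    (α' : (𝒢.pull b' v' h').pullback ⋙ Fe' ≅ F') :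
    (Hom.id 𝒢).alignedBranchSubgroup b' v' h' b p F' Fe' α' = 𝒢.branchSubgroup F' b' h' Fe' α' := by
  subst p
  -- the aligned frame is `α'` up to unitors
  have hframe : ∀ X : 𝒢.V v',
      ((Hom.id 𝒢).alignIso b' v' h' _ rfl F' Fe' α').hom.app X = α'.hom.app X := by
    intro X
    change Fe'.map (((𝒢.pull b' v' h').pullback.leftUnitor ≪≫
        (𝒢.pull b' v' h').pullback.rightUnitor.symm).inv.app X) ≫ α'.hom.app X = α'.hom.app X
    simp only [Iso.trans_inv, Iso.symm_inv, NatTrans.comp_app, Functor.rightUnitor_hom_app,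
      Functor.leftUnitor_inv_app]
    erw [Category.id_comp, CategoryTheory.Functor.map_id, Category.id_comp]
  have hframe' : ∀ X : 𝒢.V v',
      ((Hom.id 𝒢).alignIso b' v' h' _ rfl F' Fe' α').inv.app X = α'.inv.app X := by
    intro X
    have h2 : ((Hom.id 𝒢).alignIso b' v' h' _ rfl F' Fe' α').hom.app X ≫ α'.inv.app X = 𝟙 _ := by
      rw [hframe X]
      exact α'.hom_inv_id_app X
    exact Iso.inv_ext (f := ((Hom.id 𝒢).alignIso b' v' h' _ rfl F' Fe' α').app X) h2
  -- both subgroups are ranges of "conjugate `π₁(b'^*)` by the frame"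
  have key : ∀ τ : Aut Fe',
      Aut.autMulEquivOfIso ((Hom.id 𝒢).alignIso b' v' h' _ rfl F' Fe' α')
          (pi1Map (𝒢.pull b' v' h').pullback
            (((Hom.id 𝒢).φE (𝒢.graph.edgeOf b') (𝒢.graph.edgeOf ((Hom.id 𝒢).base.branchMap b'))
              (by rw [← (rfl : (Hom.id 𝒢).base.branchMap b' = _)]
                  exact ((Hom.id 𝒢).base.edgeOf_branchMap b').symm)).pullback ⋙ Fe') τ) =
        Aut.autMulEquivOfIso α' (pi1Map (𝒢.pull b' v' h').pullback Fe' τ) := by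
    intro τ
    apply Iso.ext
    apply NatTrans.ext
    funext X
    change ((Hom.id 𝒢).alignIso b' v' h' _ rfl F' Fe' α').inv.app X ≫ τ.hom.app _ ≫
        ((Hom.id 𝒢).alignIso b' v' h' _ rfl F' Fe' α').hom.app X =
      α'.inv.app X ≫ τ.hom.app _ ≫ α'.hom.app X
    rw [hframe X, hframe' X]
    rfl
  apply le_antisymm
  · rintro x ⟨τ, rfl⟩
    exact ⟨τ, (key τ).symm⟩
  · rintro x ⟨τ, rfl⟩
    exact ⟨τ, key τ⟩

/-- **The identity 1-morphism is BRANCH-ALIGNED** ([SemiAnbd] Def. 2.2 (i) bookkeeping, FACT-LIST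
row F-1492 at the identity): clause (i) `ι⁻¹(Π_b^{al}) ≤ Π_{b'}` since `Π_b^{al} = Π_{b'}`
(`Hom.id_alignedBranchSubgroup_eq`) and `ι = π₁(𝟭) = id`; clause (ii) is vacuous — two branches of `𝒢`
over the same branch along the identity are equal. [cite: MochizukiSemiAnbd2006, Def. 2.2(i) p.23] -/
theorem Hom.id_isBranchAligned : (Hom.id 𝒢).IsBranchAligned := by
  intro v' F' _ b
  refine ⟨?_, ?_⟩
  · intro b' h' p Fe' _ α' x hx
    have hx' : pi1Map ((Hom.id 𝒢).φV v').pullback F' x = x :=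
      Iso.ext (NatTrans.ext (funext fun _ => rfl))
    rwa [Subgroup.mem_comap, Hom.id_alignedBranchSubgroup_eq, hx'] at hx
  · intro b'₁ b'₂ h₁ h₂ p₁ p₂ hne
    exact absurd (p₁.trans p₂.symm) hne

/-! ### E. Vertex alignment of the identity -/

/-- `π₁(id^*)` is the identity on `Π_𝒢 = Aut(ρ_v ⋙ F')`: the components of an automorphism at
`id^* B` and at `B` agree (naturality along `idPullbackIso`, whose vertex components are identities).
[cite: MochizukiSemiAnbd2006, Rem. 2.2.1 p.24] -/
theorem Hom.pi1Map_idPullback_apply (v : 𝒢.graph.Vertex) (F' : 𝒢.V v ⥤ FintypeCat.{v₁})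
    (y : Aut (𝒢.ρ v ⋙ F')) :
    pi1Map (Hom.id 𝒢).pullbackFunctor (𝒢.ρ v ⋙ F') y = y := by
  apply Iso.ext
  apply NatTrans.ext
  funext B
  have hnat := y.hom.naturality ((Hom.idPullbackIso (𝒢 := 𝒢)).hom.app B)
  have h1 : (𝒢.ρ v ⋙ F').map ((Hom.idPullbackIso (𝒢 := 𝒢)).hom.app B) = 𝟙 _ := by
    change F'.map (((Hom.idPullbackIso (𝒢 := 𝒢)).hom.app B).fS v) = 𝟙 _
    rw [Hom.idPullbackIso_hom_app_fS]
    exact F'.map_id _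
  rw [h1] at hnat
  erw [Category.comp_id, Category.id_comp] at hnat
  exact hnat.symm

/-- **`ι = conj_e`**: for the identity, the homomorphism `ι : Π_𝒢(ρ_{v'} ⋙ F') → Π_𝒢(ρ_v ⋙ F)` of the
dictionary (`π₁(id^*)` followed by transport along `e : id_{v'}^* ⋙ F' ≅ F`) is conjugation by `ρ_v e`.
[cite: MochizukiSemiAnbd2006, Rem. 2.2.1 p.24] -/
theorem Hom.id_ι_eq (v' : 𝒢.graph.Vertex) (F' : 𝒢.V v' ⥤ FintypeCat.{v₁})
    (F : 𝒢.V ((Hom.id 𝒢).base.vertexMap v') ⥤ FintypeCat.{v₁})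
    (e : ((Hom.id 𝒢).φV v').pullback ⋙ F' ≅ F) :
    (Aut.autMulEquivOfIso (isoWhiskerLeft (𝒢.ρ ((Hom.id 𝒢).base.vertexMap v')) e)).toMonoidHom.comp
        (pi1Map (Hom.id 𝒢).pullbackFunctor (𝒢.ρ v' ⋙ F')) =
      (Aut.autMulEquivOfIso (isoWhiskerLeft (𝒢.ρ ((Hom.id 𝒢).base.vertexMap v')) e)).toMonoidHom := by
  refine MonoidHom.ext fun y => ?_
  change Aut.autMulEquivOfIso _ (pi1Map (Hom.id 𝒢).pullbackFunctor (𝒢.ρ v' ⋙ F') y) = _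
  rw [Hom.pi1Map_idPullback_apply]
  rfl

/-- Clause (a) of vertex alignment for the identity: `ι(Π_{v'}) = Π' ∩ Π_v` — indeed `Π' = Π_𝒢`
(`ι` is a bijection) and `conj_{ρ e}` carries the verticial subgroup for `F'` onto the one for `F`.
[cite: MochizukiSemiAnbd2006, Rem. 2.2.1 p.24] -/
theorem Hom.id_vertexAligned_base (v' : 𝒢.graph.Vertex) (F' : 𝒢.V v' ⥤ FintypeCat.{v₁})
    (F : 𝒢.V ((Hom.id 𝒢).base.vertexMap v') ⥤ FintypeCat.{v₁})
    (e : ((Hom.id 𝒢).φV v').pullback ⋙ F' ≅ F) :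
    (((Aut.autMulEquivOfIso (isoWhiskerLeft (𝒢.ρ ((Hom.id 𝒢).base.vertexMap v')) e)).toMonoidHom.comp
          (pi1Map (Hom.id 𝒢).pullbackFunctor (𝒢.ρ v' ⋙ F'))).comp (𝒢.piVToPi v' F')).range =
      ((Aut.autMulEquivOfIso (isoWhiskerLeft (𝒢.ρ ((Hom.id 𝒢).base.vertexMap v')) e)).toMonoidHom.comp
          (pi1Map (Hom.id 𝒢).pullbackFunctor (𝒢.ρ v' ⋙ F'))).range ⊓
        (𝒢.piVToPi ((Hom.id 𝒢).base.vertexMap v') F).range := by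
  -- `ι` is surjective (`π₁(id^*) = id`, then a conjugation)
  have hsurj : Function.Surjective
      ((Aut.autMulEquivOfIso (isoWhiskerLeft (𝒢.ρ ((Hom.id 𝒢).base.vertexMap v')) e)).toMonoidHom.comp
        (pi1Map (Hom.id 𝒢).pullbackFunctor (𝒢.ρ v' ⋙ F'))) := fun y =>
    ⟨(Aut.autMulEquivOfIso (isoWhiskerLeft (𝒢.ρ ((Hom.id 𝒢).base.vertexMap v')) e)).symm y,
      (congrArg (Aut.autMulEquivOfIso (isoWhiskerLeft (𝒢.ρ ((Hom.id 𝒢).base.vertexMap v')) e))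
        (Hom.pi1Map_idPullback_apply v' F' _)).trans (MulEquiv.apply_symm_apply _ y)⟩
  -- `ι ∘ π₁(ρ_{v'})_{F'} = π₁(ρ_v)_F ∘ conj_e`
  have h1 : ((Aut.autMulEquivOfIso
        (isoWhiskerLeft (𝒢.ρ ((Hom.id 𝒢).base.vertexMap v')) e)).toMonoidHom.comp
          (pi1Map (Hom.id 𝒢).pullbackFunctor (𝒢.ρ v' ⋙ F'))).comp (𝒢.piVToPi v' F') =
      (𝒢.piVToPi ((Hom.id 𝒢).base.vertexMap v') F).comp (Aut.autMulEquivOfIso e).toMonoidHom := by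
    refine MonoidHom.ext fun z => ?_
    have hz : pi1Map (Hom.id 𝒢).pullbackFunctor (𝒢.ρ v' ⋙ F') (𝒢.piVToPi v' F' z) =
        pi1Map (𝒢.ρ ((Hom.id 𝒢).base.vertexMap v')) (((Hom.id 𝒢).φV v').pullback ⋙ F') z :=
      Iso.ext (NatTrans.ext (funext fun _ => rfl))
    exact (congrArg (Aut.autMulEquivOfIso (isoWhiskerLeft (𝒢.ρ ((Hom.id 𝒢).base.vertexMap v')) e))
      hz).trans (autMulEquivOfIso_whiskerLeft_pi1Map _ e z)
  have htop' : (Aut.autMulEquivOfIso e).toMonoidHom.range = ⊤ :=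
    MonoidHom.range_eq_top.mpr (Aut.autMulEquivOfIso e).surjective
  have hce : ((𝒢.piVToPi ((Hom.id 𝒢).base.vertexMap v') F).comp
        (Aut.autMulEquivOfIso e).toMonoidHom).range =
      (𝒢.piVToPi ((Hom.id 𝒢).base.vertexMap v') F).range := by
    rw [MonoidHom.range_comp, htop', ← MonoidHom.range_eq_map]
  refine ((congrArg MonoidHom.range h1).trans hce).trans ?_
  rw [MonoidHom.range_eq_top.mpr hsurj, top_inf_eq]

/-- Clause (b) of vertex alignment for the identity: for a second basepoint `F''` of `𝒢_{v'}` and any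
transport `α : ρ_{v'} ⋙ F'' ≅ ρ_{v'} ⋙ F'` of the induced basepoints of `B(𝒢)`, `ι(conj_α Π_{v'}(F''))`
is a conjugate `g⁻¹ Π_v g` of the verticial subgroup — `g` from an isomorphism `F'' ≅ F'` of fibre
functors ([SGA1 V 5.7]) via `map_range_pi1Map_autMulEquivOfIso`. [cite: MochizukiSemiAnbd2006, Rem. 2.2.1 p.24] -/
theorem Hom.id_vertexAligned_conj (v' : 𝒢.graph.Vertex) (F' : 𝒢.V v' ⥤ FintypeCat.{v₁})
    [FiberFunctor F'] (F : 𝒢.V ((Hom.id 𝒢).base.vertexMap v') ⥤ FintypeCat.{v₁})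
    (e : ((Hom.id 𝒢).φV v').pullback ⋙ F' ≅ F)
    (F'' : 𝒢.V v' ⥤ FintypeCat.{v₁}) [FiberFunctor F''] (α : 𝒢.ρ v' ⋙ F'' ≅ 𝒢.ρ v' ⋙ F') :
    ∃ g : 𝒢.Pi ((Hom.id 𝒢).base.vertexMap v') F,
      (((Aut.autMulEquivOfIso (isoWhiskerLeft (𝒢.ρ ((Hom.id 𝒢).base.vertexMap v')) e)).toMonoidHom.comp
            (pi1Map (Hom.id 𝒢).pullbackFunctor (𝒢.ρ v' ⋙ F'))).comp
          ((Aut.autMulEquivOfIso α).toMonoidHom.comp (𝒢.piVToPi v' F''))).range =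
        ((Aut.autMulEquivOfIso (isoWhiskerLeft (𝒢.ρ ((Hom.id 𝒢).base.vertexMap v')) e)).toMonoidHom.comp
            (pi1Map (Hom.id 𝒢).pullbackFunctor (𝒢.ρ v' ⋙ F'))).range ⊓
          ConjAct.toConjAct g⁻¹ • (𝒢.piVToPi ((Hom.id 𝒢).base.vertexMap v') F).range := by
  obtain ⟨γ⟩ := nonempty_iso_of_fiberFunctor F'' F'
  obtain ⟨g, hg⟩ := map_range_pi1Map_autMulEquivOfIso (𝒢.ρ ((Hom.id 𝒢).base.vertexMap v'))
    (γ ≪≫ e) (α ≪≫ isoWhiskerLeft (𝒢.ρ ((Hom.id 𝒢).base.vertexMap v')) e)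
  refine ⟨g, ?_⟩
  -- `ι` is surjective
  have hsurj : Function.Surjective
      ((Aut.autMulEquivOfIso (isoWhiskerLeft (𝒢.ρ ((Hom.id 𝒢).base.vertexMap v')) e)).toMonoidHom.comp
        (pi1Map (Hom.id 𝒢).pullbackFunctor (𝒢.ρ v' ⋙ F'))) := fun y =>
    ⟨(Aut.autMulEquivOfIso (isoWhiskerLeft (𝒢.ρ ((Hom.id 𝒢).base.vertexMap v')) e)).symm y,
      (congrArg (Aut.autMulEquivOfIso (isoWhiskerLeft (𝒢.ρ ((Hom.id 𝒢).base.vertexMap v')) e))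
        (Hom.pi1Map_idPullback_apply v' F' _)).trans (MulEquiv.apply_symm_apply _ y)⟩
  -- `ι ∘ conj_α = conj_{α ≫ ρ e}`
  have h2 : ((Aut.autMulEquivOfIso
        (isoWhiskerLeft (𝒢.ρ ((Hom.id 𝒢).base.vertexMap v')) e)).toMonoidHom.comp
          (pi1Map (Hom.id 𝒢).pullbackFunctor (𝒢.ρ v' ⋙ F'))).comp
        ((Aut.autMulEquivOfIso α).toMonoidHom.comp (𝒢.piVToPi v' F'')) =
      (Aut.autMulEquivOfIso (α ≪≫ isoWhiskerLeft (𝒢.ρ ((Hom.id 𝒢).base.vertexMap v')) e)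
          ).toMonoidHom.comp (𝒢.piVToPi v' F'') := by
    refine MonoidHom.ext fun z => ?_
    exact (congrArg (Aut.autMulEquivOfIso (isoWhiskerLeft (𝒢.ρ ((Hom.id 𝒢).base.vertexMap v')) e))
      (Hom.pi1Map_idPullback_apply v' F' _)).trans (autMulEquivOfIso_trans _ _ _).symm
  have hL : ((((Aut.autMulEquivOfIso
        (isoWhiskerLeft (𝒢.ρ ((Hom.id 𝒢).base.vertexMap v')) e)).toMonoidHom.comp
          (pi1Map (Hom.id 𝒢).pullbackFunctor (𝒢.ρ v' ⋙ F'))).comp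
        ((Aut.autMulEquivOfIso α).toMonoidHom.comp (𝒢.piVToPi v' F''))).range) =
      ConjAct.toConjAct g⁻¹ • (𝒢.piVToPi ((Hom.id 𝒢).base.vertexMap v') F).range :=
    (congrArg MonoidHom.range h2).trans ((MonoidHom.range_comp _ _).trans hg)
  refine hL.trans ?_
  rw [MonoidHom.range_eq_top.mpr hsurj, top_inf_eq]

/-- **The identity 1-morphism is VERTEX-ALIGNED** ([SemiAnbd] Rem. 2.2.1 bookkeeping, FACT-LIST
row F-2531 at the identity): (a) `ι(Π_{v'}) = Π' ∩ Π_v` with `Π' = Π_𝒢` (`Hom.id_vertexAligned_base`);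
(b) the verticial subgroups for the other basepoints over `v'` are conjugates `Π' ∩ g⁻¹ Π_v g`
(`Hom.id_vertexAligned_conj`). [cite: MochizukiSemiAnbd2006, Rem. 2.2.1 p.24] -/
theorem Hom.id_isVertexAligned : (Hom.id 𝒢).IsVertexAligned := by
  intro v' F' _ F _ e
  refine ⟨Hom.id_vertexAligned_base v' F' F e, ?_⟩
  intro v'' F'' _ α
  obtain ⟨w, hw⟩ := v''
  change w = v' at hw
  subst hw
  exact Hom.id_vertexAligned_conj w F' F e F'' α

end SemiGraphOfAnabelioids

end Literature.AnabelianGeometry.SemiGraphs
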